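import Summits.BirchSwinnertonDyer.Rank1Residual.X2.ClassClosureOfDerivedF0
import Summits.BirchSwinnertonDyer.Rank1Residual.X2.GreenbergVatsalThm13GoodOrdinaryTateFree
import Summits.BirchSwinnertonDyer.Rank1Residual.X2.NonPrimitiveLambdaInvariantMultiplicativeDerived
import HarnessLib

/-!
# The X2 terms of record RE-THREADED through the datum record: `X2.TargetA` and GV Thm (1.3)
# (good ordinary, Tate-free) with the GV-(6)–(7) binders A133 / A115 replaced by their gen-26
# derivations from `datumSelmer_nonPrimitive_invariants` (T-GV23L)

HONEST FRAMING (BSD rank-`≤ 1` residual cell `b2b-bsdres`, home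
`run/shared/lean/b2b/bsd-rank1-residual/`, unit `b2b-bsdres-eisenstein-p2`, class X2; research route,
no claim beyond stated classes): the cell deletes the COMBINATION-SHAPED residual classes of the
rank-`≤ 1` BSD formula from PUBLISHED theorems only and TYPES the construction-shaped ones; this is
not "finishing BSD". THEOREMS ONLY (no definition, no named fact, nothing asserted, nothing booked;
labels are the referee's). Bookkeeping compositions:

* `targetA_of_datum_heightFree` — `X2.TargetA` (sub-cell X2a: `r_an = 0 ∧ GVPar`) from the binders
  of `ClassClosureOfDerivedF0.targetA_of_derivedF0_heightFree` with
  `hA : lambda_nonPrimitive_eq_add_sum_delta_multiplicative` (A133) REPLACED by the datum record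
  `h23 : datumSelmer_nonPrimitive_invariants` (T-GV23L) and the trivial-zero record
  `hInf : datumStrictSelmer_relIndex_eq_zero_of_split` (A137′), through
  `NonPrimitiveLambdaInvariantMultiplicativeDerived.lambda_nonPrimitive_eq_add_sum_delta_multiplicative_of_datum`
  (A40/A41 are already binders). Eighteen binders; registry inputs: A40, A41, T-GV23L, A137′, A135,
  A137, A195, A180, A226, A224, A225, A33, A37×2, A18, A19 + parametrisation, `greenberg_stevens`.
* `thm13_charIdeal_eq_of_gvPar_tateFree_of_datum` — GV Thm (1.3) in its printed good-ordinary
  setting (A14) from `GreenbergVatsalThm13GoodOrdinaryTateFree.thm13_charIdeal_eq_of_gvPar_tateFree`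
  with `hA : lambda_nonPrimitive_eq_add_sum_delta` (A115) REPLACED by T-GV23L through
  `NonPrimitiveLambdaInvariantOfDatum.lambda_nonPrimitive_eq_add_sum_delta_of_datum` — A14 ⇐
  {A111, T-GV23L, A116, A195, A180, Wuthrich Thm 16, A226, A224, A225}.

References: GV 2000 Thm. (1.3), §1 (5)–(7), §2 Prop. (2.1), Cor. (2.3), Prop. (2.4), pp. 14–15, 26.
-/

noncomputable section

open scoped Classical AddSubgroup MatrixGroups ModularForm

namespace Summit.BirchSwinnertonDyer.Rank1Residual.X2.ClassClosureOfDatum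

open PowerSeries NumberField IsDedekindDomain Field WeierstrassCurve CongruenceSubgroup
  Literature.NumberTheory.EllipticCurves Literature.NumberTheory.EllipticCurves.GreenbergVatsal2000
  Literature.NumberTheory.EllipticCurves.ModularForms
  Literature.NumberTheory.EllipticCurves.Rank1Residual
  Literature.NumberTheory.EllipticCurves.Rank1Residual.Typed
  Literature.NumberTheory.EllipticCurves.Greenberg1999
  Literature.NumberTheory.EllipticCurves.Wuthrich2014
  Literature.NumberTheory.EllipticCurves.SteinWuthrich2013
  Literature.NumberTheory.EllipticCurves.Disegni2020
  Summit.BirchSwinnertonDyer.Rank1Residual.X2.GreenbergVatsalInputsOfFacts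
  Summit.BirchSwinnertonDyer.Rank1Residual.X2.EisensteinCongruenceOfFacts
  Summit.BirchSwinnertonDyer.Rank1Residual.X2.GreenbergProp510OfFacts
  Summit.BirchSwinnertonDyer.Rank1Residual.X2.GreenbergVatsalOfUnfoldedFacts
  Summit.BirchSwinnertonDyer.Rank1Residual.X2.GreenbergVatsalOfDerivedProp510
  Summit.BirchSwinnertonDyer.Rank1Residual.X2.IsogenyQuotientLine
  Summit.BirchSwinnertonDyer.Rank1Residual.X2.IsogenyLineTypeGoodOrdinary
  Summit.BirchSwinnertonDyer.Rank1Residual.X2.IsogenyLambdaInvariant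
  Summit.BirchSwinnertonDyer.Rank1Residual.X2.GreenbergVatsalAnalyticTransferCore
  Summit.BirchSwinnertonDyer.Rank1Residual.X2.GreenbergVatsalCaseTwo
  Summit.BirchSwinnertonDyer.Rank1Residual.X2.GreenbergVatsalCaseOneGoodOrdinary
  Summit.BirchSwinnertonDyer.Rank1Residual.X2.GreenbergVatsalThm13GoodOrdinary
  Summit.BirchSwinnertonDyer.Rank1Residual.X2.ClassClosureOfDerivedF0
  Summit.BirchSwinnertonDyer.Rank1Residual.X2.GreenbergVatsalThm13GoodOrdinaryTateFree
  Summit.BirchSwinnertonDyer.Rank1Residual.X2.NonPrimitiveLambdaInvariantOfDatum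
  Summit.BirchSwinnertonDyer.Rank1Residual.X2.NonPrimitiveLambdaInvariantMultiplicativeDerived

/-- **`X2.TargetA` (X2a: `r_an = 0 ∧ GVPar`, every odd `p ‖ N`) with the GV-(5)–(7) binder A133
replaced by the datum record T-GV23L and the trivial-zero record A137′** — the term of record
`targetA_of_derivedF0_heightFree` fed with
`lambda_nonPrimitive_eq_add_sum_delta_multiplicative_of_datum h23 hT hT' hInf`. Bookkeeping.
[cite: GreenbergVatsal2000, Thm. (1.3) with pp. 1, 14–15; §2 Prop. (2.1), Cor. (2.3), Prop. (2.4); §3 Thm. (3.11)]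
[cite: Wuthrich2014, Thm. 16 (p. 397)] [cite: SteinWuthrich2013, Thm. 6.1 (p. 20)] -/
theorem targetA_of_datum_heightFree
    (h23 : datumSelmer_nonPrimitive_invariants)
    (hInf : datumStrictSelmer_relIndex_eq_zero_of_split)
    (hT : Silverman1994_thmV53_tateUniformisation.{0})
    (hT' : Silverman1994_thmV53_corV54_tateUniformisation.{0})
    (hB : datumSelmer_divisible_of_finite_torsionBy)
    (hF : datumStrictSelmer_lt_datumSelmer_of_split)
    (hLiftF : residualEpsilon_surjOn_of_lineRamifiedEven)
    (hP : cor38_realPeriodRat_eq_unit_mul_of_isIsogenous_of_gvPar)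
    (h311 : thm311_hasUnitContent_iff_and_order_eq_of_lineRamifiedEven)
    (hC : characterLFunctionC_hasUnitContent_and_order_eq_card)
    (hD : characterLFunctionD_hasUnitContent_and_order_eq_card)
    (hWu : thm16_charIdeal_dvd_multiplicative_of_reducible)
    (hJs : thm61_splitMultiplicative) (hJn : thm61_nonsplitMultiplicative)
    (hGZK : rank_eq_analyticRank_of_analyticRank_le_one) (hmod : hasEntireLFunction_rat)
    (hpar : nonempty_modularParametrizationData)
    (hGS : ∀ (W : WeierstrassCurve ℚ) [W.IsElliptic] [W.IsGloballyMinimal] (p : ℕ) [Fact p.Prime],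
      greenberg_stevens (W := W) (p := p)) :
    TargetA :=
  targetA_of_derivedF0_heightFree hT hT'
    (lambda_nonPrimitive_eq_add_sum_delta_multiplicative_of_datum h23 hT hT' hInf) hB hF hLiftF hP
    h311 hC hD hWu hJs hJn hGZK hmod hpar hGS

/-- **GV Thm (1.3), printed good-ordinary setting (A14), Tate-free, with A115 replaced by the datum
record T-GV23L** — `thm13_charIdeal_eq_of_gvPar_tateFree` fed with
`lambda_nonPrimitive_eq_add_sum_delta_of_datum h23 hGV`: A14 ⇐ {A111, T-GV23L, A116, A195, A180,
Wuthrich Thm 16, A226, A224, A225}. Bookkeeping.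
[cite: GreenbergVatsal2000, Thm. (1.3); §1 (6)–(7); §2 Cor. (2.3), Prop. (2.4), p. 26; §3 Thm. (3.11)]
[cite: Wuthrich2014, Thm. 16 (p. 397)] -/
theorem thm13_charIdeal_eq_of_gvPar_tateFree_of_datum
    (hGV : imKummer_ge_greenbergCondition_at_p) (h23 : datumSelmer_nonPrimitive_invariants)
    (hB : divisible_nonPrimitiveSelmerInfty_of_mu_eq_zero)
    (hLiftF : residualEpsilon_surjOn_of_lineRamifiedEven)
    (hP : cor38_realPeriodRat_eq_unit_mul_of_isIsogenous_of_gvPar)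
    (hW16 : Wuthrich2014.charIdeal_dvd_padicLFunction)
    (h311 : thm311_hasUnitContent_iff_and_order_eq_of_lineRamifiedEven)
    (hC : characterLFunctionC_hasUnitContent_and_order_eq_card)
    (hD : characterLFunctionD_hasUnitContent_and_order_eq_card) :
    thm13_charIdeal_eq_of_gvPar :=
  thm13_charIdeal_eq_of_gvPar_tateFree hGV (lambda_nonPrimitive_eq_add_sum_delta_of_datum h23 hGV) hB
    hLiftF hP hW16 h311 hC hD

end Summit.BirchSwinnertonDyer.Rank1Residual.X2.ClassClosureOfDatum

end
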